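import Mathlib
import Summits.NavierStokesRegularity.OSWSelfSimilar.SheetHalfLineIdentity
import HarnessLib

/-!
# Viscous gCLM/OSW profile MODEL: the FIRST-MOMENT (virial) identity of the frozen-`ε` sheet map,
# the TAIL LAW it becomes on the NS-type line, and the sign law it forces for `a < 0`

HONEST FRAMING (cell ns-blowup GROUP B «PROFILE SEARCH», zone Z3 = the 1-D viscous gCLM/OSW sheet; human rulings
D-0035/D-0074): **1-D MODEL; one-variable calculus kernel-checked; not Euler, not Navier–Stokes; «violates: none — MODEL».**
Nothing in this file is a statement about Navier–Stokes.

OBJECT. The frozen-`ε` profile («sheet») map of the viscous generalised Constantin–Lax–Majda / Okamoto–Sakajo–Wunsch model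
in the cell's gauge (HOME/profile/z3/SHEET.md §1.2), written as `HouLuoOriginLaws.F1`:
  `F₁(ξ) = c_ω Ω + c_l ξ Ω′ + a 𝒰 Ω′ − b (HΩ) Ω − P − ε Ω″`,   `𝒰′ = HΩ`, `Ω(0) = 0`
(gCLM/OSW sheet: `b = 1`, `P = 0`; blow-up `c_ω > 0`, collapse `c_l > 0`; the NS-type line = constant viscosity is
`c_ω = 2 c_l`, `Literature.Analysis.FluidPDE.effectiveViscosity_half`). As in `SheetHalfLineIdentity` (the half-line identity
(★), test function `𝟙_{ξ>0}`) and its energy identity (test function `Ω`), `H` and `U` are ARBITRARY real functions tied only by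
`𝒰′ = H`; everything here is calculus on `[0, R]` and limits `R → ∞`. The two genuinely nonlocal inputs — the MOMENT NULL
`∫₀^∞ ξ (HΩ) Ω = 0` and the VELOCITY SIGN `𝒰 ≥ 0` on `(0,∞)` for odd `Ω ≤ 0` on `(0,∞)` when `H` is the Hilbert transform and
`𝒰(0) = 0` — enter as explicit hypotheses (`hmom`, `hUnn`, `hUstrict`), discharged for `H = hilbertTransform Ω` in companion
files.

WHAT IS KERNEL-CHECKED HERE (test `F₁` against `ξ·𝟙_{[0,R]}`; the FOURTH exact null of the sheet map after the origin law,
(★) and the energy identity):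
* `moment_identity_interval` — for every `R ≥ 0`,
    `(c_ω − 2c_l)∫₀ᴿ ξΩ + c_l R²Ω(R) + a R 𝒰(R)Ω(R) − a∫₀ᴿ 𝒰Ω − (a+b)∫₀ᴿ ξ(HΩ)Ω − ∫₀ᴿ ξP − ε R Ω′(R) + ε Ω(R) = 0`.   (M_R)
  (By parts: `∫₀ᴿ ξ²Ω′ = R²Ω(R) − 2∫₀ᴿ ξΩ`, `∫₀ᴿ ξ𝒰Ω′ = R𝒰(R)Ω(R) − ∫₀ᴿ (𝒰 + ξHΩ)Ω`, `∫₀ᴿ ξΩ″ = RΩ′(R) − Ω(R)`; only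
  `Ω(0) = 0` is used, not `𝒰(0)`. Hypotheses: `ξ(HΩ)Ω` and `ξP` integrable on `[0,R]`; `ξΩ″` is read off `F₁ ≡ 0`.)
* `moment_identity` — if `ξΩ, 𝒰Ω, ξ(HΩ)Ω, ξP ∈ L¹(0,∞)` and `R²Ω(R), R𝒰(R)Ω(R), RΩ′(R), Ω(R) → 0`, then
    `(c_ω − 2c_l)∫₀^∞ ξΩ = a∫₀^∞ 𝒰Ω + (a+b)∫₀^∞ ξ(HΩ)Ω + ∫₀^∞ ξP`                                         (M)
  — the form valid for tails faster than `ξ⁻²` (`c_ω > 2c_l` on the collapse sheet; e.g. the exact row `c_l = c_ω/3`, where (M)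
  REPRODUCES the amplitude law `a c w = 8/3` of `SheetRowThirdExactFamily` — companion check file).
* `nsLine_tail_law` — **ON THE NS-TYPE LINE `c_ω = 2c_l` the divergent term `∫₀ᴿ ξΩ` has coefficient ZERO**, and (M_R) turns
  into a statement about the `ξ⁻²` TAIL AMPLITUDE `A = lim ξ²Ω(ξ)`: if `𝒰Ω, ξ(HΩ)Ω, ξP ∈ L¹(0,∞)` and
  `R𝒰(R)Ω(R), RΩ′(R), Ω(R) → 0`, then `c_l ξ²Ω(ξ)` CONVERGES as `ξ → ∞`, to
    `a∫₀^∞ 𝒰Ω + (a+b)∫₀^∞ ξ(HΩ)Ω + ∫₀^∞ ξP`;                                                                  (T)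
  for the gCLM sheet with the moment null: **`c_l · A = a ∫₀^∞ 𝒰Ω`** (`nsLine_tail_law_gCLM`). READINGS (MODEL): at the CLM point
  `a = 0` every NS-type-line profile has `A = 0` (no `ξ⁻²` tail — the Schochet corner `−24vξ/(ξ²+v²)²` decays like `ξ⁻³`,
  `nsLine_tail_zero_of_a_eq_zero`); for `a ≠ 0` the tail amplitude is the velocity–vorticity pairing (E½, `a > 0`: `A < 0`).
* `nsLine_trivial_of_nonpos_of_a_neg` — **SIGN LAW 3: for `a < 0` the NS-type line carries NO E-signed blow-up profile.** On
  `c_ω = 2c_l`, `c_l > 0` (blow-up), ANY `ε` (no sign needed), `b = 1`, `P = 0`: a `C²` profile with `Ω(0) = 0`, `Ω ≤ 0` on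
  `(0,∞)`, in the decay class of (T), with the moment null, OUTWARD velocity `𝒰 ≥ 0` on `(0,∞)` and the strictness clause
  «`𝒰(ξ) = 0 ⇒ Ω(ξ) = 0` for `ξ > 0`», vanishes on `(0,∞)`: in (T) the left side `c_l A` is `≤ 0` and the right side
  `a∫₀^∞𝒰Ω` is `≥ 0`, so `∫₀^∞ 𝒰Ω = 0`, `𝒰Ω ≡ 0`, `Ω ≡ 0`. With the companion files this is the census decl
  `nsTypeLine_ESigned_empty_of_a_neg` (every `a < 0`), extending `nsTypeLine_ESigned_empty_of_a_le_neg_one` (`a ≤ −1`, from (★))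
  to the whole range `−1 < a < 0` of CENSUS-Z3 row Z3-E12⁻ clause (i′), where the cell's word was the search word «NONE FOUND».
NOT PROVED HERE: the two nonlocal inputs (companion files); anything dynamic (the «arrest» half of clause (i′) stays class (D)
numerics); existence of anything; anything about Euler or NS.
bears_on: LADDER-NS N5 / zone Z3 clause (i′) (CENSUS-Z3 v2.9 §0) → N1 linear core; SELFSIM-NOGO M7/M8 MODEL side.
-/

noncomputable section
open Set Filter Topology MeasureTheory

namespace Summit.NavierStokesRegularity.OSWSelfSimilar
namespace SheetHalfLine
open HouLuoOriginLaws (F1)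

/-! ### The first-moment identity on `[0, R]` -/

/-- **THE FIRST-MOMENT IDENTITY (M_R) of the frozen-`ε` sheet map on `[0,R]`** (explicit-hypothesis form). Let `Ω` be `C²`
on `ℝ` (`Ω′ = dOm`, `Ω″ = ddOm`), `Ω(0) = 0`, `𝒰′ = H` everywhere, `F₁ ≡ 0` on `(0,∞)`, and let `ξ(HΩ)Ω`, `ξP` be integrable on
`[0,R]`, `R ≥ 0`. Then
`(c_ω − 2c_l)∫₀ᴿ ξΩ + c_l R²Ω(R) + aR𝒰(R)Ω(R) − a∫₀ᴿ 𝒰Ω − (a+b)∫₀ᴿ ξ(HΩ)Ω − ∫₀ᴿ ξP − εRΩ′(R) + εΩ(R) = 0`.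
[new here — MODEL] -/
theorem moment_identity_interval (cω cl a b ε : ℝ) (H U Om dOm ddOm P : ℝ → ℝ)
    (hU : ∀ ξ, HasDerivAt U (H ξ) ξ) (hOm : ∀ ξ, HasDerivAt Om (dOm ξ) ξ) (hdOm : ∀ ξ, HasDerivAt dOm (ddOm ξ) ξ)
    (hOm0 : Om 0 = 0) (hF : ∀ ξ ∈ Ioi (0:ℝ), F1 cω cl a b ε H U Om dOm ddOm P ξ = 0)
    {R : ℝ} (hR : 0 ≤ R)
    (iH : IntervalIntegrable (fun ξ => ξ * (H ξ * Om ξ)) volume 0 R)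
    (iP : IntervalIntegrable (fun ξ => ξ * P ξ) volume 0 R) :
    (cω - 2 * cl) * (∫ ξ in (0:ℝ)..R, ξ * Om ξ) + cl * (R ^ 2 * Om R) + a * (R * U R * Om R)
      - a * (∫ ξ in (0:ℝ)..R, U ξ * Om ξ) - (a + b) * (∫ ξ in (0:ℝ)..R, ξ * (H ξ * Om ξ))
      - (∫ ξ in (0:ℝ)..R, ξ * P ξ) - ε * (R * dOm R) + ε * Om R = 0 := by
  have cOm : Continuous Om := continuous_iff_continuousAt.mpr fun x => (hOm x).continuousAt
  have cdOm : Continuous dOm := continuous_iff_continuousAt.mpr fun x => (hdOm x).continuousAt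
  have cU : Continuous U := continuous_iff_continuousAt.mpr fun x => (hU x).continuousAt
  have hIcc : uIcc (0:ℝ) R = Icc 0 R := uIcc_of_le hR
  have hIoc : uIoc (0:ℝ) R = Ioc 0 R := uIoc_of_le hR
  -- (i) ∫₀ᴿ (2ξΩ + ξ²Ω′) = R²Ω(R)
  have h1 : ∫ ξ in (0:ℝ)..R, (2 * ξ * Om ξ + ξ ^ 2 * dOm ξ) = R ^ 2 * Om R := by
    have hd : ∀ ξ ∈ uIcc (0:ℝ) R, HasDerivAt (fun x => x * (x * Om x)) (2 * ξ * Om ξ + ξ ^ 2 * dOm ξ) ξ := by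
      intro ξ _
      have h := (hasDerivAt_id' ξ).mul ((hasDerivAt_id' ξ).mul (hOm ξ))
      refine h.congr_deriv ?_
      simp only [Pi.mul_apply]
      ring
    have hi : IntervalIntegrable (fun ξ => 2 * ξ * Om ξ + ξ ^ 2 * dOm ξ) volume 0 R :=
      (Continuous.intervalIntegrable (by fun_prop) _ _)
    have h := intervalIntegral.integral_eq_sub_of_hasDerivAt hd hi
    rw [h]
    ring
  -- (ii) ∫₀ᴿ (𝒰Ω + ξ(HΩ)Ω + ξ𝒰Ω′) = R𝒰(R)Ω(R)
  have h2 : ∫ ξ in (0:ℝ)..R, (U ξ * Om ξ + ξ * (H ξ * Om ξ) + ξ * (U ξ * dOm ξ)) = R * U R * Om R := by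
    have hd : ∀ ξ ∈ uIcc (0:ℝ) R,
        HasDerivAt (fun x => x * (U x * Om x)) (U ξ * Om ξ + ξ * (H ξ * Om ξ) + ξ * (U ξ * dOm ξ)) ξ := by
      intro ξ _
      have h := (hasDerivAt_id' ξ).mul ((hU ξ).mul (hOm ξ))
      refine h.congr_deriv ?_
      simp only [Pi.mul_apply]
      ring
    have hi : IntervalIntegrable (fun ξ => U ξ * Om ξ + ξ * (H ξ * Om ξ) + ξ * (U ξ * dOm ξ)) volume 0 R :=
      ((Continuous.intervalIntegrable (by fun_prop) _ _).add iH).add (Continuous.intervalIntegrable (by fun_prop) _ _)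
    have h := intervalIntegral.integral_eq_sub_of_hasDerivAt hd hi
    rw [h, hOm0]
    ring
  -- (iii) ∫₀ᴿ ε ξ Ω″ = ε (RΩ′(R) − Ω(R))   (ξΩ″ is read off F₁ ≡ 0 on (0,∞); no hypothesis on Ω″ is needed)
  have h3 : ∫ ξ in (0:ℝ)..R, ε * (ξ * ddOm ξ) = ε * (R * dOm R - Om R) := by
    have hd : ∀ ξ ∈ uIcc (0:ℝ) R, HasDerivAt (fun x => ε * (x * dOm x - Om x)) (ε * (ξ * ddOm ξ)) ξ := by
      intro ξ _
      have h := (((hasDerivAt_id' ξ).mul (hdOm ξ)).sub (hOm ξ)).const_mul ε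
      refine h.congr_deriv ?_
      ring
    -- integrability: on (0,R], ε ξ Ω″ = ξ (c_ω Ω + c_l ξΩ′ + a𝒰Ω′ − b(HΩ)Ω − P)
    have hi : IntervalIntegrable (fun ξ => ε * (ξ * ddOm ξ)) volume 0 R := by
      have hg : IntervalIntegrable
          (fun ξ => ξ * (cω * Om ξ + cl * ξ * dOm ξ + a * U ξ * dOm ξ) - b * (ξ * (H ξ * Om ξ)) - ξ * P ξ)
          volume 0 R :=
        ((Continuous.intervalIntegrable (by fun_prop) _ _).sub (iH.const_mul b)).sub iP
      rw [intervalIntegrable_iff] at hg ⊢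
      rw [hIoc] at hg ⊢
      refine hg.congr_fun (fun ξ hξ => ?_) measurableSet_Ioc
      have hF' := hF ξ hξ.1
      unfold HouLuoOriginLaws.F1 at hF'
      have : ε * ddOm ξ = cω * Om ξ + cl * ξ * dOm ξ + a * U ξ * dOm ξ - b * H ξ * Om ξ - P ξ := by linarith
      dsimp only
      rw [show ε * (ξ * ddOm ξ) = ξ * (ε * ddOm ξ) from by ring, this]
      ring
    have h := intervalIntegral.integral_eq_sub_of_hasDerivAt hd hi
    rw [h, hOm0]
    ring
  -- ∫₀ᴿ ξ·F₁ = 0 (the integrand vanishes on [0,R]: at ξ = 0 trivially, on (0,R] by F₁ ≡ 0)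
  have key : ∫ ξ in (0:ℝ)..R, ξ * F1 cω cl a b ε H U Om dOm ddOm P ξ = 0 := by
    have hz : EqOn (fun ξ => ξ * F1 cω cl a b ε H U Om dOm ddOm P ξ) (fun _ => 0) (uIcc 0 R) := by
      intro ξ hξ
      rw [hIcc] at hξ
      rcases eq_or_lt_of_le hξ.1 with h0 | hpos
      · simp [← h0]
      · simp [hF ξ hpos]
    rw [intervalIntegral.integral_congr hz]
    simp
  have hre : ∀ ξ, ξ * F1 cω cl a b ε H U Om dOm ddOm P ξ =
      ((cω - 2 * cl) * (ξ * Om ξ) + cl * (2 * ξ * Om ξ + ξ ^ 2 * dOm ξ)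
          + a * (U ξ * Om ξ + ξ * (H ξ * Om ξ) + ξ * (U ξ * dOm ξ)))
        - (a * (U ξ * Om ξ) + (a + b) * (ξ * (H ξ * Om ξ)) + ξ * P ξ + ε * (ξ * ddOm ξ)) := by
    intro ξ
    unfold HouLuoOriginLaws.F1
    ring
  have iA1 : IntervalIntegrable (fun ξ => (cω - 2 * cl) * (ξ * Om ξ)) volume 0 R :=
    Continuous.intervalIntegrable (by fun_prop) _ _
  have iA2 : IntervalIntegrable (fun ξ => cl * (2 * ξ * Om ξ + ξ ^ 2 * dOm ξ)) volume 0 R :=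
    Continuous.intervalIntegrable (by fun_prop) _ _
  have iA3 : IntervalIntegrable (fun ξ => a * (U ξ * Om ξ + ξ * (H ξ * Om ξ) + ξ * (U ξ * dOm ξ))) volume 0 R :=
    (((Continuous.intervalIntegrable (by fun_prop) _ _).add iH).add
      (Continuous.intervalIntegrable (by fun_prop) _ _)).const_mul a
  have iA12 : IntervalIntegrable
      (fun ξ => (cω - 2 * cl) * (ξ * Om ξ) + cl * (2 * ξ * Om ξ + ξ ^ 2 * dOm ξ)) volume 0 R := iA1.add iA2
  have iA : IntervalIntegrable
      (fun ξ => (cω - 2 * cl) * (ξ * Om ξ) + cl * (2 * ξ * Om ξ + ξ ^ 2 * dOm ξ)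
        + a * (U ξ * Om ξ + ξ * (H ξ * Om ξ) + ξ * (U ξ * dOm ξ))) volume 0 R := iA12.add iA3
  have iB1 : IntervalIntegrable (fun ξ => a * (U ξ * Om ξ)) volume 0 R :=
    Continuous.intervalIntegrable (by fun_prop) _ _
  have iB2 : IntervalIntegrable (fun ξ => (a + b) * (ξ * (H ξ * Om ξ))) volume 0 R := iH.const_mul _
  have iB4 : IntervalIntegrable (fun ξ => ε * (ξ * ddOm ξ)) volume 0 R := by
    -- same integrability argument as in (iii)
    have hg : IntervalIntegrable
        (fun ξ => ξ * (cω * Om ξ + cl * ξ * dOm ξ + a * U ξ * dOm ξ) - b * (ξ * (H ξ * Om ξ)) - ξ * P ξ)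
        volume 0 R :=
      ((Continuous.intervalIntegrable (by fun_prop) _ _).sub (iH.const_mul b)).sub iP
    rw [intervalIntegrable_iff] at hg ⊢
    rw [hIoc] at hg ⊢
    refine hg.congr_fun (fun ξ hξ => ?_) measurableSet_Ioc
    have hF' := hF ξ hξ.1
    unfold HouLuoOriginLaws.F1 at hF'
    have : ε * ddOm ξ = cω * Om ξ + cl * ξ * dOm ξ + a * U ξ * dOm ξ - b * H ξ * Om ξ - P ξ := by linarith
    dsimp only
    rw [show ε * (ξ * ddOm ξ) = ξ * (ε * ddOm ξ) from by ring, this]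
    ring
  have iB12 : IntervalIntegrable (fun ξ => a * (U ξ * Om ξ) + (a + b) * (ξ * (H ξ * Om ξ))) volume 0 R :=
    iB1.add iB2
  have iB123 : IntervalIntegrable
      (fun ξ => a * (U ξ * Om ξ) + (a + b) * (ξ * (H ξ * Om ξ)) + ξ * P ξ) volume 0 R := iB12.add iP
  have iB : IntervalIntegrable
      (fun ξ => a * (U ξ * Om ξ) + (a + b) * (ξ * (H ξ * Om ξ)) + ξ * P ξ + ε * (ξ * ddOm ξ)) volume 0 R :=
    iB123.add iB4
  simp_rw [hre] at key
  rw [intervalIntegral.integral_sub iA iB, intervalIntegral.integral_add iA12 iA3,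
    intervalIntegral.integral_add iA1 iA2, intervalIntegral.integral_add iB123 iB4,
    intervalIntegral.integral_add iB12 iP, intervalIntegral.integral_add iB1 iB2,
    intervalIntegral.integral_const_mul, intervalIntegral.integral_const_mul, intervalIntegral.integral_const_mul,
    intervalIntegral.integral_const_mul, intervalIntegral.integral_const_mul, h1, h2, h3] at key
  linear_combination key

/-! ### The limit `R → ∞`: the identity (M) for fast tails and the TAIL LAW (T) on the NS-type line -/

/-- **(M), the first-moment identity for tails faster than `ξ⁻²`.** Under the hypotheses of `moment_identity_interval` for every
`R ≥ 0`, if `ξΩ, 𝒰Ω, ξ(HΩ)Ω, ξP ∈ L¹(0,∞)` and `R²Ω(R) → 0`, `R𝒰(R)Ω(R) → 0`, `RΩ′(R) → 0`, `Ω(R) → 0` as `R → ∞`, then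
`(c_ω − 2c_l)∫₀^∞ ξΩ = a∫₀^∞ 𝒰Ω + (a+b)∫₀^∞ ξ(HΩ)Ω + ∫₀^∞ ξP`. [new here — MODEL] -/
theorem moment_identity (cω cl a b ε : ℝ) (H U Om dOm ddOm P : ℝ → ℝ)
    (hU : ∀ ξ, HasDerivAt U (H ξ) ξ) (hOm : ∀ ξ, HasDerivAt Om (dOm ξ) ξ) (hdOm : ∀ ξ, HasDerivAt dOm (ddOm ξ) ξ)
    (hOm0 : Om 0 = 0) (hF : ∀ ξ ∈ Ioi (0:ℝ), F1 cω cl a b ε H U Om dOm ddOm P ξ = 0)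
    (iξOm : IntegrableOn (fun ξ => ξ * Om ξ) (Ioi 0)) (iUOm : IntegrableOn (fun ξ => U ξ * Om ξ) (Ioi 0))
    (iH : IntegrableOn (fun ξ => ξ * (H ξ * Om ξ)) (Ioi 0)) (iP : IntegrableOn (fun ξ => ξ * P ξ) (Ioi 0))
    (hsq : Tendsto (fun R => R ^ 2 * Om R) atTop (𝓝 0)) (hUOm : Tendsto (fun R => R * U R * Om R) atTop (𝓝 0))
    (hdOm1 : Tendsto (fun R => R * dOm R) atTop (𝓝 0)) (hOmInf : Tendsto Om atTop (𝓝 0)) :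
    (cω - 2 * cl) * (∫ ξ in Ioi (0:ℝ), ξ * Om ξ)
      = a * (∫ ξ in Ioi (0:ℝ), U ξ * Om ξ) + (a + b) * (∫ ξ in Ioi (0:ℝ), ξ * (H ξ * Om ξ))
        + ∫ ξ in Ioi (0:ℝ), ξ * P ξ := by
  -- interval integrability on [0,R] from integrability on (0,∞)
  have hII : ∀ {f : ℝ → ℝ}, IntegrableOn f (Ioi 0) → ∀ {R : ℝ}, 0 ≤ R → IntervalIntegrable f volume 0 R := by
    intro f hf R hR
    rw [intervalIntegrable_iff, uIoc_of_le hR]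
    exact hf.mono_set Ioc_subset_Ioi_self
  -- the finite identity, eventually in R
  have hev : ∀ᶠ R in atTop,
      (cω - 2 * cl) * (∫ ξ in (0:ℝ)..R, ξ * Om ξ) + cl * (R ^ 2 * Om R) + a * (R * U R * Om R)
        - a * (∫ ξ in (0:ℝ)..R, U ξ * Om ξ) - (a + b) * (∫ ξ in (0:ℝ)..R, ξ * (H ξ * Om ξ))
        - (∫ ξ in (0:ℝ)..R, ξ * P ξ) - ε * (R * dOm R) + ε * Om R = 0 := by
    filter_upwards [eventually_ge_atTop (0:ℝ)] with R hR
    exact moment_identity_interval cω cl a b ε H U Om dOm ddOm P hU hOm hdOm hOm0 hF hR (hII iH hR) (hII iP hR)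
  -- every term has a limit
  have hI1 : Tendsto (fun R => ∫ ξ in (0:ℝ)..R, ξ * Om ξ) atTop (𝓝 (∫ ξ in Ioi (0:ℝ), ξ * Om ξ)) :=
    intervalIntegral_tendsto_integral_Ioi 0 iξOm tendsto_id
  have hI2 : Tendsto (fun R => ∫ ξ in (0:ℝ)..R, U ξ * Om ξ) atTop (𝓝 (∫ ξ in Ioi (0:ℝ), U ξ * Om ξ)) :=
    intervalIntegral_tendsto_integral_Ioi 0 iUOm tendsto_id
  have hI3 : Tendsto (fun R => ∫ ξ in (0:ℝ)..R, ξ * (H ξ * Om ξ)) atTop (𝓝 (∫ ξ in Ioi (0:ℝ), ξ * (H ξ * Om ξ))) :=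
    intervalIntegral_tendsto_integral_Ioi 0 iH tendsto_id
  have hI4 : Tendsto (fun R => ∫ ξ in (0:ℝ)..R, ξ * P ξ) atTop (𝓝 (∫ ξ in Ioi (0:ℝ), ξ * P ξ)) :=
    intervalIntegral_tendsto_integral_Ioi 0 iP tendsto_id
  have hlim : Tendsto (fun R =>
      (cω - 2 * cl) * (∫ ξ in (0:ℝ)..R, ξ * Om ξ) + cl * (R ^ 2 * Om R) + a * (R * U R * Om R)
        - a * (∫ ξ in (0:ℝ)..R, U ξ * Om ξ) - (a + b) * (∫ ξ in (0:ℝ)..R, ξ * (H ξ * Om ξ))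
        - (∫ ξ in (0:ℝ)..R, ξ * P ξ) - ε * (R * dOm R) + ε * Om R) atTop
      (𝓝 ((cω - 2 * cl) * (∫ ξ in Ioi (0:ℝ), ξ * Om ξ) + cl * 0 + a * 0
        - a * (∫ ξ in Ioi (0:ℝ), U ξ * Om ξ) - (a + b) * (∫ ξ in Ioi (0:ℝ), ξ * (H ξ * Om ξ))
        - (∫ ξ in Ioi (0:ℝ), ξ * P ξ) - ε * 0 + ε * 0)) :=
    (((((((hI1.const_mul _).add (hsq.const_mul _)).add (hUOm.const_mul _)).sub (hI2.const_mul _)).sub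
      (hI3.const_mul _)).sub hI4).sub (hdOm1.const_mul _)).add (hOmInf.const_mul _)
  have hzero := hlim.congr' (hev.mono fun R hR => hR)
  have huniq := tendsto_nhds_unique hzero tendsto_const_nhds
  linear_combination huniq

/-- **(T), THE TAIL LAW ON THE NS-TYPE LINE `c_ω = 2c_l`.** Under the hypotheses of `moment_identity_interval` (every `R ≥ 0`)
with `c_ω = 2c_l`, if `𝒰Ω, ξ(HΩ)Ω, ξP ∈ L¹(0,∞)` and `R𝒰(R)Ω(R) → 0`, `RΩ′(R) → 0`, `Ω(R) → 0`, then the `ξ⁻²` tail amplitude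
EXISTS: `c_l ξ²Ω(ξ) → a∫₀^∞ 𝒰Ω + (a+b)∫₀^∞ ξ(HΩ)Ω + ∫₀^∞ ξP` as `ξ → ∞` (the divergent `∫₀ᴿ ξΩ` has coefficient `c_ω − 2c_l = 0`).
[new here — MODEL] -/
theorem nsLine_tail_law (cl a b ε : ℝ) (H U Om dOm ddOm P : ℝ → ℝ)
    (hU : ∀ ξ, HasDerivAt U (H ξ) ξ) (hOm : ∀ ξ, HasDerivAt Om (dOm ξ) ξ) (hdOm : ∀ ξ, HasDerivAt dOm (ddOm ξ) ξ)
    (hOm0 : Om 0 = 0) (hF : ∀ ξ ∈ Ioi (0:ℝ), F1 (2 * cl) cl a b ε H U Om dOm ddOm P ξ = 0)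
    (iUOm : IntegrableOn (fun ξ => U ξ * Om ξ) (Ioi 0))
    (iH : IntegrableOn (fun ξ => ξ * (H ξ * Om ξ)) (Ioi 0)) (iP : IntegrableOn (fun ξ => ξ * P ξ) (Ioi 0))
    (hUOm : Tendsto (fun R => R * U R * Om R) atTop (𝓝 0))
    (hdOm1 : Tendsto (fun R => R * dOm R) atTop (𝓝 0)) (hOmInf : Tendsto Om atTop (𝓝 0)) :
    Tendsto (fun R => cl * (R ^ 2 * Om R)) atTop
      (𝓝 (a * (∫ ξ in Ioi (0:ℝ), U ξ * Om ξ) + (a + b) * (∫ ξ in Ioi (0:ℝ), ξ * (H ξ * Om ξ))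
        + ∫ ξ in Ioi (0:ℝ), ξ * P ξ)) := by
  have hII : ∀ {f : ℝ → ℝ}, IntegrableOn f (Ioi 0) → ∀ {R : ℝ}, 0 ≤ R → IntervalIntegrable f volume 0 R := by
    intro f hf R hR
    rw [intervalIntegrable_iff, uIoc_of_le hR]
    exact hf.mono_set Ioc_subset_Ioi_self
  -- on the NS-type line the finite identity reads: cl R²Ω(R) = a∫₀ᴿ𝒰Ω + (a+b)∫₀ᴿξ(HΩ)Ω + ∫₀ᴿξP + εRΩ′(R) − εΩ(R) − aR𝒰(R)Ω(R)
  have hev : ∀ᶠ R in atTop,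
      a * (∫ ξ in (0:ℝ)..R, U ξ * Om ξ) + (a + b) * (∫ ξ in (0:ℝ)..R, ξ * (H ξ * Om ξ))
        + (∫ ξ in (0:ℝ)..R, ξ * P ξ) + ε * (R * dOm R) - ε * Om R - a * (R * U R * Om R)
        = cl * (R ^ 2 * Om R) := by
    filter_upwards [eventually_ge_atTop (0:ℝ)] with R hR
    have h := moment_identity_interval (2 * cl) cl a b ε H U Om dOm ddOm P hU hOm hdOm hOm0 hF hR (hII iH hR) (hII iP hR)
    linear_combination -h
  have hI2 : Tendsto (fun R => ∫ ξ in (0:ℝ)..R, U ξ * Om ξ) atTop (𝓝 (∫ ξ in Ioi (0:ℝ), U ξ * Om ξ)) :=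
    intervalIntegral_tendsto_integral_Ioi 0 iUOm tendsto_id
  have hI3 : Tendsto (fun R => ∫ ξ in (0:ℝ)..R, ξ * (H ξ * Om ξ)) atTop (𝓝 (∫ ξ in Ioi (0:ℝ), ξ * (H ξ * Om ξ))) :=
    intervalIntegral_tendsto_integral_Ioi 0 iH tendsto_id
  have hI4 : Tendsto (fun R => ∫ ξ in (0:ℝ)..R, ξ * P ξ) atTop (𝓝 (∫ ξ in Ioi (0:ℝ), ξ * P ξ)) :=
    intervalIntegral_tendsto_integral_Ioi 0 iP tendsto_id
  have hlim : Tendsto (fun R =>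
      a * (∫ ξ in (0:ℝ)..R, U ξ * Om ξ) + (a + b) * (∫ ξ in (0:ℝ)..R, ξ * (H ξ * Om ξ))
        + (∫ ξ in (0:ℝ)..R, ξ * P ξ) + ε * (R * dOm R) - ε * Om R - a * (R * U R * Om R)) atTop
      (𝓝 (a * (∫ ξ in Ioi (0:ℝ), U ξ * Om ξ) + (a + b) * (∫ ξ in Ioi (0:ℝ), ξ * (H ξ * Om ξ))
        + (∫ ξ in Ioi (0:ℝ), ξ * P ξ) + ε * 0 - ε * 0 - a * 0)) :=
    (((((hI2.const_mul _).add (hI3.const_mul _)).add hI4).add (hdOm1.const_mul _)).sub (hOmInf.const_mul _)).sub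
      (hUOm.const_mul _)
  have h := hlim.congr' (hev.mono fun R hR => hR)
  simpa using h

/-! ### The gCLM/OSW sheet proper (`b = 1`, `P = 0`) on the NS-type line -/

/-- **Tail law for the gCLM sheet on the NS-type line, given the moment null `∫₀^∞ ξ(HΩ)Ω = 0`:**
`c_l ξ²Ω(ξ) → a ∫₀^∞ 𝒰Ω`, i.e. `c_l · A = a ∫₀^∞ 𝒰Ω` for the `ξ⁻²` tail amplitude `A = lim ξ²Ω`. [new here — MODEL] -/
theorem nsLine_tail_law_gCLM (cl a ε : ℝ) (H U Om dOm ddOm : ℝ → ℝ)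
    (hU : ∀ ξ, HasDerivAt U (H ξ) ξ) (hOm : ∀ ξ, HasDerivAt Om (dOm ξ) ξ) (hdOm : ∀ ξ, HasDerivAt dOm (ddOm ξ) ξ)
    (hOm0 : Om 0 = 0) (hF : ∀ ξ ∈ Ioi (0:ℝ), F1 (2 * cl) cl a 1 ε H U Om dOm ddOm (fun _ => 0) ξ = 0)
    (iUOm : IntegrableOn (fun ξ => U ξ * Om ξ) (Ioi 0))
    (iH : IntegrableOn (fun ξ => ξ * (H ξ * Om ξ)) (Ioi 0))
    (hUOm : Tendsto (fun R => R * U R * Om R) atTop (𝓝 0))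
    (hdOm1 : Tendsto (fun R => R * dOm R) atTop (𝓝 0)) (hOmInf : Tendsto Om atTop (𝓝 0))
    (hmom : ∫ ξ in Ioi (0:ℝ), ξ * (H ξ * Om ξ) = 0) :
    Tendsto (fun R => cl * (R ^ 2 * Om R)) atTop (𝓝 (a * ∫ ξ in Ioi (0:ℝ), U ξ * Om ξ)) := by
  have h := nsLine_tail_law cl a 1 ε H U Om dOm ddOm (fun _ => 0) hU hOm hdOm hOm0 hF iUOm iH
    (by simp only [mul_zero]; exact integrableOn_zero) hUOm hdOm1 hOmInf
  simpa [hmom] using h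

/-- **At the CLM point `a = 0` every NS-type-line profile has NO `ξ⁻²` tail: `ξ²Ω(ξ) → 0`** (any `c_l ≠ 0`, any `ε`), given the
moment null. Reading (MODEL): on the NS-type line at `a = 0` the algebraic `ξ⁻²` tail of the collapse sheet is absent — as for
the exact Schochet corner `Ω_S = −24vξ/(ξ²+v²)²` (`SheetNSLineSchochetCorner`), which decays like `ξ⁻³`. [new here — MODEL] -/
theorem nsLine_tail_zero_of_a_eq_zero (cl ε : ℝ) (H U Om dOm ddOm : ℝ → ℝ) (hcl : cl ≠ 0)
    (hU : ∀ ξ, HasDerivAt U (H ξ) ξ) (hOm : ∀ ξ, HasDerivAt Om (dOm ξ) ξ) (hdOm : ∀ ξ, HasDerivAt dOm (ddOm ξ) ξ)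
    (hOm0 : Om 0 = 0) (hF : ∀ ξ ∈ Ioi (0:ℝ), F1 (2 * cl) cl 0 1 ε H U Om dOm ddOm (fun _ => 0) ξ = 0)
    (iUOm : IntegrableOn (fun ξ => U ξ * Om ξ) (Ioi 0))
    (iH : IntegrableOn (fun ξ => ξ * (H ξ * Om ξ)) (Ioi 0))
    (hUOm : Tendsto (fun R => R * U R * Om R) atTop (𝓝 0))
    (hdOm1 : Tendsto (fun R => R * dOm R) atTop (𝓝 0)) (hOmInf : Tendsto Om atTop (𝓝 0))
    (hmom : ∫ ξ in Ioi (0:ℝ), ξ * (H ξ * Om ξ) = 0) :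
    Tendsto (fun R => R ^ 2 * Om R) atTop (𝓝 0) := by
  have h := nsLine_tail_law_gCLM cl 0 ε H U Om dOm ddOm hU hOm hdOm hOm0 hF iUOm iH hUOm hdOm1 hOmInf hmom
  rw [zero_mul] at h
  have h' := h.const_mul cl⁻¹
  simp only [mul_zero] at h'
  refine h'.congr' (Eventually.of_forall fun R => ?_)
  field_simp

/-! ### SIGN LAW 3: for `a < 0` the NS-type line carries no E-signed blow-up profile -/

/-- A function continuous and `≤ 0` on `(0,∞)` whose integral over `(0,∞)` vanishes (and which is integrable there) vanishes on
`(0,∞)`. [folklore] -/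
theorem eqOn_zero_of_nonpos_of_integral_eq_zero {f : ℝ → ℝ} (hc : ContinuousOn f (Ioi 0))
    (hneg : ∀ x ∈ Ioi (0:ℝ), f x ≤ 0) (hi : IntegrableOn f (Ioi 0)) (hint : ∫ x in Ioi (0:ℝ), f x = 0) :
    EqOn f 0 (Ioi 0) := by
  have h := eqOn_zero_of_nonneg_of_integral_eq_zero (f := fun x => -f x) hc.neg
    (fun x hx => by have := hneg x hx; linarith) hi.neg (by rw [integral_neg, hint, neg_zero])
  intro x hx
  have := h hx
  simp only [Pi.zero_apply, neg_eq_zero] at this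
  simpa using this

/-- **SIGN LAW 3 (explicit-hypothesis form): for `a < 0`, on the NS-type line `c_ω = 2c_l` of the blow-up sheet (`c_l > 0`; ANY
`ε`), an E-signed profile vanishes.** Let `Ω` be `C²`, `Ω(0) = 0`, `Ω ≤ 0` on `(0,∞)`, `𝒰′ = H`, `F₁ ≡ 0` on `(0,∞)` with `b = 1`,
`P = 0`, in the decay class of (T) (`𝒰Ω, ξ(HΩ)Ω ∈ L¹(0,∞)`; `R𝒰(R)Ω(R), RΩ′(R), Ω(R) → 0`), and assume the two nonlocal inputs
of the genuine Hilbert transform: the moment null `∫₀^∞ ξ(HΩ)Ω = 0` and the OUTWARD-velocity law «`𝒰 ≥ 0` on `(0,∞)`, and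
`𝒰(ξ) = 0 ⇒ Ω(ξ) = 0` for `ξ > 0`» (companion files; both hold for odd `Ω ≤ 0` on `(0,∞)` with `𝒰(0) = 0`). Then `Ω ≡ 0` on
`(0,∞)`. Proof: by (T) `c_l ξ²Ω → a∫₀^∞𝒰Ω`; the left side is eventually `≤ 0`, the right side is `≥ 0` (`a < 0`, `𝒰Ω ≤ 0`),
so `∫₀^∞ 𝒰Ω = 0`, hence `𝒰Ω ≡ 0` and `Ω ≡ 0` on `(0,∞)`. [new here — MODEL] -/
theorem nsLine_trivial_of_nonpos_of_a_neg (cl a ε : ℝ) (H U Om dOm ddOm : ℝ → ℝ) (hcl : 0 < cl) (ha : a < 0)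
    (hU : ∀ ξ, HasDerivAt U (H ξ) ξ) (hOm : ∀ ξ, HasDerivAt Om (dOm ξ) ξ) (hdOm : ∀ ξ, HasDerivAt dOm (ddOm ξ) ξ)
    (hOm0 : Om 0 = 0) (hF : ∀ ξ ∈ Ioi (0:ℝ), F1 (2 * cl) cl a 1 ε H U Om dOm ddOm (fun _ => 0) ξ = 0)
    (iUOm : IntegrableOn (fun ξ => U ξ * Om ξ) (Ioi 0))
    (iH : IntegrableOn (fun ξ => ξ * (H ξ * Om ξ)) (Ioi 0))
    (hUOm : Tendsto (fun R => R * U R * Om R) atTop (𝓝 0))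
    (hdOm1 : Tendsto (fun R => R * dOm R) atTop (𝓝 0)) (hOmInf : Tendsto Om atTop (𝓝 0))
    (hmom : ∫ ξ in Ioi (0:ℝ), ξ * (H ξ * Om ξ) = 0)
    (hsign : ∀ ξ ∈ Ioi (0:ℝ), Om ξ ≤ 0) (hUnn : ∀ ξ ∈ Ioi (0:ℝ), 0 ≤ U ξ)
    (hUstrict : ∀ ξ ∈ Ioi (0:ℝ), U ξ = 0 → Om ξ = 0) :
    EqOn Om 0 (Ioi 0) := by
  have htail := nsLine_tail_law_gCLM cl a ε H U Om dOm ddOm hU hOm hdOm hOm0 hF iUOm iH hUOm hdOm1 hOmInf hmom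
  -- the limit c_l·A is ≤ 0 (Ω ≤ 0 eventually)
  have hle : a * (∫ ξ in Ioi (0:ℝ), U ξ * Om ξ) ≤ 0 := by
    refine le_of_tendsto htail ?_
    filter_upwards [eventually_gt_atTop (0:ℝ)] with R hR
    have h1 : Om R ≤ 0 := hsign R hR
    have h2 : R ^ 2 * Om R ≤ 0 := mul_nonpos_of_nonneg_of_nonpos (sq_nonneg R) h1
    exact mul_nonpos_of_nonneg_of_nonpos hcl.le h2
  -- the pairing ∫₀^∞ 𝒰Ω is ≤ 0, so a·∫₀^∞𝒰Ω ≥ 0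
  have hJ : ∫ ξ in Ioi (0:ℝ), U ξ * Om ξ ≤ 0 :=
    setIntegral_nonpos measurableSet_Ioi fun ξ hξ => mul_nonpos_of_nonneg_of_nonpos (hUnn ξ hξ) (hsign ξ hξ)
  have hge : 0 ≤ a * (∫ ξ in Ioi (0:ℝ), U ξ * Om ξ) := mul_nonneg_of_nonpos_of_nonpos ha.le hJ
  have hJ0 : ∫ ξ in Ioi (0:ℝ), U ξ * Om ξ = 0 := by
    have h0 : a * (∫ ξ in Ioi (0:ℝ), U ξ * Om ξ) = 0 := le_antisymm hle hge
    rcases mul_eq_zero.mp h0 with h | h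
    · exact absurd h (ne_of_lt ha)
    · exact h
  -- hence 𝒰Ω ≡ 0 on (0,∞)
  have cU : Continuous U := continuous_iff_continuousAt.mpr fun x => (hU x).continuousAt
  have cOm : Continuous Om := continuous_iff_continuousAt.mpr fun x => (hOm x).continuousAt
  have hc : ContinuousOn (fun ξ => U ξ * Om ξ) (Ioi 0) := (cU.mul cOm).continuousOn
  have hz := eqOn_zero_of_nonpos_of_integral_eq_zero hc
    (fun ξ hξ => mul_nonpos_of_nonneg_of_nonpos (hUnn ξ hξ) (hsign ξ hξ)) iUOm hJ0
  -- and Ω ≡ 0 on (0,∞)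
  intro ξ hξ
  have h := hz hξ
  simp only [Pi.zero_apply, mul_eq_zero] at h
  rcases h with hU0 | hO0
  · exact hUstrict ξ hξ hU0
  · exact hO0

end SheetHalfLine
end Summit.NavierStokesRegularity.OSWSelfSimilar
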